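import Summits.QuantumFields.QCD.Theses.NestedDissectionSea
import Summits.QuantumFields.QCD.Theorems.CoerciveSea.Negative.CellCoercivity
import Summits.QuantumFields.QCD.Theorems.NestedDissectionSeaKineticEdge
import Summits.QuantumFields.QCD.Theorems.NestedDissectionSeaCoerciveSeaChiralKineticEmpty

/-!
# Crux `CoerciveSea` (stmt-QuantumFields-13901), line `chirality-collapses-pseudospectrum`,
# stub `stub_achiralPileupRareOfPinned` (B″-law) — deterministic reductions (supports)

The B″-law (the ACHIRAL sector of the Hermitian Dirichlet Wilson cell pencil
`D_c(μ) u = ev · Γ_c u`, `D_c(μ) = wilsonCell U μ 0 s`, rarely piles sheet weight `> s₀/(4t)` onto the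
pinned valence mass, uniformly in `k`) is OPEN.  This file lands the deterministic facts that shrink
its content, over the EXACT event of the registered stub:

* (imported from the lead's landed `…CoerciveSeaChiralKineticEmpty`: `star_mul_cell_eq_ev_mul_chirality` —
  for an eigenvector of the pencil `⟨u, D_c u⟩ = ev · χ(u)`, `χ(u) = Σ_p conj(u_p) (γ₅)_{α_p α_p} u_p` the
  chirality — and `sum_norm_sq_eq_one_of_star_mul_self`.)
* `achiralMode_kineticEdge_lt` — NUMERICAL-RANGE / KINETIC-EDGE OBSTRUCTION: a unit eigenvector with
  `|ev| < 2τ` and `‖χ(u)‖ < χ₀` forces `μ + Σ_i (1 − cos(π/s_i)) < 2τχ₀`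
  (`(μ + 4 − Σ cos(π/s_i))‖u‖² ≤ Re⟨u, D_c u⟩ = Re(ev·χ) ≤ |ev| ‖χ‖`, by the landed kinetic edge
  `KineticEdge.re_quadForm_wilsonCell_ge` = diamagnetic inequality + Dirichlet path-graph bound).
* `achiralPileup_kineticEdge_lt` — the B″ event of the stub (verbatim shape) is therefore EMPTY on
  every cell with `μ + Σ_i (1 − cos(π/s_i)) ≥ 2τχ₀` (the pile-up `> 1/(4τ) ≥ 0` forces a member);
  `achiralPileup_mass_lt` — the cruder `μ < 2τχ₀` with no `s ≤ N` side condition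
  (`CoerciveSeaNegative.re_inner_compressed_ge`).
* `achiralPileup_ratio_eq_zero_of_kineticEdge` — hence the phase-quenched ratio `P(B″)` of the stub
  (verbatim shape: Bochner integrals against `wilsonMeasure (fundamentalRep (Fin 3)) β` with the
  weight `Π_f ‖det D_W(U, mq f)‖`) VANISHES on such cells, for every torus, coupling, weight masses.

Sibling file `NestedDissectionSeaCoerciveSeaAchiralPileupRareOneSite.lean` records the EXPOSURE of
the `∀ reg` form of the stub (on the one-site box at sea mass `−4` the event is certain).

What remains open after this file (reported to the lead as the blocked goal): the `k`-uniform power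
law `P(B″_t) ≤ C t^α` on the cells with `m_f(k) + Σ_i (1 − cos(π/s_i)) < 2(t/s₀)χ₀` — which, for a
pinned regularisation (`limsup mcrit ≤ 0`, `m_f(k) − mcrit k → 0`), includes every top-window cell
as soon as `liminf mcrit < 0`, the kinetic edge of a cell of side `ℓ/a_k` being `≍ 2π² a_k²/ℓ² → 0`.
-/

noncomputable section

open scoped BigOperators Classical ComplexConjugate
open MeasureTheory Filter Matrix
open Literature.MathematicalPhysics.QuantumLattice Literature.MathematicalPhysics.QuantumFieldTheory
  Literature.Probability.LatticeModels
open Summit.QuantumFields.QCD.Theorems.KineticEdge Summit.QuantumFields.QCD.Theorems.CoerciveSeaNegative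
  Summit.QuantumFields.QCD.Theorems.NestedDissectionSeaCoerciveSea

namespace Summit.QuantumFields.QCD.Cruxes.CoerciveSea.ChiralityCollapsesPseudospectrum

variable {N : ℕ} [NeZero N]

/-! ## The chirality identity and the kinetic-edge obstruction for one achiral mode -/

/-- **Kinetic-edge obstruction for an achiral low mode.** On a corner-`0` box of sides `s ≤ N`, a
unit eigenvector `u` of the cell pencil at bare mass `μ` with `|ev| < 2τ` and chirality
`‖χ(u)‖ < χ₀` forces `μ + Σ_i (1 − cos(π/s_i)) < 2τχ₀`: the kinetic edge
`(μ + 4 − Σ_i cos(π/s_i)) ‖u‖² ≤ Re⟨u, D_c u⟩` (landed `KineticEdge.re_quadForm_wilsonCell_ge`) meets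
`Re⟨u, D_c u⟩ = Re(ev·χ(u)) ≤ |ev| ‖χ(u)‖ < 2τχ₀`. -/
theorem achiralMode_kineticEdge_lt (U : GaugeConfig 4 N (Matrix.specialUnitaryGroup (Fin 3) ℂ))
    (s : Fin 4 → ℕ) (hs : ∀ i, s i ≤ N) (μ τ χ₀ : ℝ)
    (u : {p // wilsonBox (0 : TorusSite 4 N) s p} → ℂ) (ev : ℝ)
    (hunit : ∑ p, star (u p) * u p = 1)
    (heig : (wilsonCell U μ 0 s).mulVec u = fun p => (ev : ℂ) * gammaFive p.1.2.2 p.1.2.2 * u p)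
    (hev : |ev| < 2 * τ) (hach : ‖∑ p, star (u p) * gammaFive p.1.2.2 p.1.2.2 * u p‖ < χ₀) :
    μ + ∑ i, (1 - Real.cos (Real.pi / s i)) < 2 * τ * χ₀ := by
  have h1 := re_quadForm_wilsonCell_ge U μ 0 s hs u
  rw [sum_norm_sq_eq_one_of_star_mul_self u hunit, mul_one] at h1
  have hid : (∑ a, conj (u a) * ((wilsonCell U μ 0 s).mulVec u) a) =
      (ev : ℂ) * ∑ p, star (u p) * gammaFive p.1.2.2 p.1.2.2 * u p :=
    star_mul_cell_eq_ev_mul_chirality U μ s u ev heig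
  rw [hid] at h1
  have h2 : ((ev : ℂ) * ∑ p, star (u p) * gammaFive p.1.2.2 p.1.2.2 * u p).re ≤
      |ev| * ‖∑ p, star (u p) * gammaFive p.1.2.2 p.1.2.2 * u p‖ := by
    refine (Complex.re_le_norm _).trans (le_of_eq ?_)
    rw [norm_mul, Complex.norm_real, Real.norm_eq_abs]
  have h3 : |ev| * ‖∑ p, star (u p) * gammaFive p.1.2.2 p.1.2.2 * u p‖ < 2 * τ * χ₀ :=
    mul_lt_mul'' hev hach (abs_nonneg _) (norm_nonneg _)
  rw [sum_one_sub_cos]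
  linarith

/-- The mass-only shadow (no `s ≤ N` side condition): a unit achiral low eigenvector forces
`μ < 2τχ₀`, by coercivity `μ‖u‖² ≤ Re⟨u, D_c u⟩` of every compressed Wilson–Dirac matrix
(landed `CoerciveSeaNegative.re_inner_compressed_ge`). -/
theorem achiralMode_mass_lt (U : GaugeConfig 4 N (Matrix.specialUnitaryGroup (Fin 3) ℂ))
    (s : Fin 4 → ℕ) (μ τ χ₀ : ℝ)
    (u : {p // wilsonBox (0 : TorusSite 4 N) s p} → ℂ) (ev : ℝ)
    (hunit : ∑ p, star (u p) * u p = 1)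
    (heig : (wilsonCell U μ 0 s).mulVec u = fun p => (ev : ℂ) * gammaFive p.1.2.2 p.1.2.2 * u p)
    (hev : |ev| < 2 * τ) (hach : ‖∑ p, star (u p) * gammaFive p.1.2.2 p.1.2.2 * u p‖ < χ₀) :
    μ < 2 * τ * χ₀ := by
  have h1 := re_inner_compressed_ge (fundamentalRep (Fin 3)) fundamentalRep_mem_unitaryGroup U μ
    (wilsonBox (0 : TorusSite 4 N) s) u
  change μ * ∑ a, ‖u a‖ ^ 2 ≤ (∑ a, conj (u a) * ((wilsonCell U μ 0 s).mulVec u) a).re at h1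
  rw [sum_norm_sq_eq_one_of_star_mul_self u hunit, mul_one] at h1
  have hid : (∑ a, conj (u a) * ((wilsonCell U μ 0 s).mulVec u) a) =
      (ev : ℂ) * ∑ p, star (u p) * gammaFive p.1.2.2 p.1.2.2 * u p :=
    star_mul_cell_eq_ev_mul_chirality U μ s u ev heig
  rw [hid] at h1
  have h2 : ((ev : ℂ) * ∑ p, star (u p) * gammaFive p.1.2.2 p.1.2.2 * u p).re ≤
      |ev| * ‖∑ p, star (u p) * gammaFive p.1.2.2 p.1.2.2 * u p‖ := by
    refine (Complex.re_le_norm _).trans (le_of_eq ?_)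
    rw [norm_mul, Complex.norm_real, Real.norm_eq_abs]
  have h3 : |ev| * ‖∑ p, star (u p) * gammaFive p.1.2.2 p.1.2.2 * u p‖ < 2 * τ * χ₀ :=
    mul_lt_mul'' hev hach (abs_nonneg _) (norm_nonneg _)
  linarith

/-! ## The B″ event of the stub is empty above the kinetic edge -/

/-- **The achiral pile-up event forces `μ + Σ_i (1 − cos(π/s_i)) < 2τχ₀`.** The event is VERBATIM
the integrand event `B″` of `stub_achiralPileupRareOfPinned` at cell mass `μ`, level `τ ≥ 0` and cut
`χ₀`: an orthonormal family of eigenvectors of the cell pencil with `|ev_j| < 2τ`, weights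
`0 ≤ wgt_j`, `wgt_j |ev_j| ≤ 1`, all achiral (`‖χ(u_j)‖ < χ₀`), piling sheet weight
`Σ_j wgt_j f(u_j) > 1/(4τ)`.  Since `1/(4τ) ≥ 0` the family has a member, to which
`achiralMode_kineticEdge_lt` applies.  Contrapositive: on cells with
`2τχ₀ ≤ μ + Σ_i (1 − cos(π/s_i))` the event is EMPTY for every gauge field. -/
theorem achiralPileup_kineticEdge_lt (U : GaugeConfig 4 N (Matrix.specialUnitaryGroup (Fin 3) ℂ))
    (s : Fin 4 → ℕ) (hs : ∀ i, s i ≤ N) (μ τ χ₀ : ℝ) (hτ : 0 ≤ τ)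
    (h : ∃ n : ℕ, ∃ u : Fin n → ({p // wilsonBox (0 : TorusSite 4 N) s p} → ℂ), ∃ ev wgt : Fin n → ℝ, (∀ i j, ∑ p, star (u i p) * u j p = if i = j then 1 else 0) ∧ (∀ j, (wilsonCell U μ 0 s).mulVec (u j) = fun p => (ev j : ℂ) * gammaFive p.1.2.2 p.1.2.2 * u j p) ∧ (∀ j, |ev j| < 2 * τ ∧ 0 ≤ wgt j ∧ wgt j * |ev j| ≤ 1) ∧ (∀ j, ‖∑ p, star (u j p) * gammaFive p.1.2.2 p.1.2.2 * u j p‖ < χ₀) ∧ 1 / (4 * τ) < ∑ j, wgt j * ∑ p, if childrenInterior s p then (0 : ℝ) else ‖u j p‖ ^ 2) :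
    μ + ∑ i, (1 - Real.cos (Real.pi / s i)) < 2 * τ * χ₀ := by
  obtain ⟨n, u, ev, wgt, horth, heig, hbd, hach, hpile⟩ := h
  rcases Nat.eq_zero_or_pos n with hn0 | hn
  · subst hn0
    simp only [Finset.univ_eq_empty, Finset.sum_empty] at hpile
    have h0 : (0 : ℝ) ≤ 1 / (4 * τ) := by positivity
    exact absurd hpile (not_lt.mpr h0)
  · set j : Fin n := ⟨0, hn⟩
    have hunit : ∑ p, star (u j p) * u j p = 1 := by rw [horth j j, if_pos rfl]
    exact achiralMode_kineticEdge_lt U s hs μ τ χ₀ (u j) (ev j) hunit (heig j) (hbd j).1 (hach j)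

/-- The mass-only shadow of `achiralPileup_kineticEdge_lt` (no `s ≤ N`): the B″ event forces
`μ < 2τχ₀`.  In the stub `τ = t/s₀ ≤ 1/2` and `χ₀ ≤ 1`, so the event is empty at every cell mass
`μ ≥ 1`, in particular throughout the heavy junk corner. -/
theorem achiralPileup_mass_lt (U : GaugeConfig 4 N (Matrix.specialUnitaryGroup (Fin 3) ℂ))
    (s : Fin 4 → ℕ) (μ τ χ₀ : ℝ) (hτ : 0 ≤ τ)
    (h : ∃ n : ℕ, ∃ u : Fin n → ({p // wilsonBox (0 : TorusSite 4 N) s p} → ℂ), ∃ ev wgt : Fin n → ℝ, (∀ i j, ∑ p, star (u i p) * u j p = if i = j then 1 else 0) ∧ (∀ j, (wilsonCell U μ 0 s).mulVec (u j) = fun p => (ev j : ℂ) * gammaFive p.1.2.2 p.1.2.2 * u j p) ∧ (∀ j, |ev j| < 2 * τ ∧ 0 ≤ wgt j ∧ wgt j * |ev j| ≤ 1) ∧ (∀ j, ‖∑ p, star (u j p) * gammaFive p.1.2.2 p.1.2.2 * u j p‖ < χ₀) ∧ 1 / (4 * τ) < ∑ j, wgt j * ∑ p, if childrenInterior s p then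 (0 : ℝ) else ‖u j p‖ ^ 2) :
    μ < 2 * τ * χ₀ := by
  obtain ⟨n, u, ev, wgt, horth, heig, hbd, hach, hpile⟩ := h
  rcases Nat.eq_zero_or_pos n with hn0 | hn
  · subst hn0
    simp only [Finset.univ_eq_empty, Finset.sum_empty] at hpile
    have h0 : (0 : ℝ) ≤ 1 / (4 * τ) := by positivity
    exact absurd hpile (not_lt.mpr h0)
  · set j : Fin n := ⟨0, hn⟩
    have hunit : ∑ p, star (u j p) * u j p = 1 := by rw [horth j j, if_pos rfl]
    exact achiralMode_mass_lt U s μ τ χ₀ (u j) (ev j) hunit (heig j) (hbd j).1 (hach j)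

/-- **The phase-quenched ratio of the B″ event vanishes above the kinetic edge.** For every odd or
even torus side `N`, coupling `β`, flavour number `Nf`, weight masses `mq`, corner-`0` box `s ≤ N`,
cell mass `μv`, level `τ ≥ 0` and cut `χ₀` with `2τχ₀ ≤ μv + Σ_i (1 − cos(π/s_i))`: the ratio
`P(B″) = (∫ 1_{B″} Π_f ‖det D_W(U, mq f)‖ dμ_β) / (∫ Π_f ‖det D_W(U, mq f)‖ dμ_β)` — VERBATIM the
stub's `P` — is `0` (the indicator vanishes identically, `achiralPileup_kineticEdge_lt`).  In the
stub: `μv = m_f(k)`, `τ = t/s₀`; this discharges the B″-law (with any `C > 0`, `α > 0`) on every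
window cell whose kinetic edge exceeds `2(t/s₀)χ₀ − m_f(k)`. -/
theorem achiralPileup_ratio_eq_zero_of_kineticEdge (N : ℕ) [NeZero N] (β : ℝ) (Nf : ℕ)
    (mq : Fin Nf → ℝ) (s : Fin 4 → ℕ) (hs : ∀ i, s i ≤ N) (μv τ χ₀ : ℝ) (hτ : 0 ≤ τ)
    (hedge : 2 * τ * χ₀ ≤ μv + ∑ i, (1 - Real.cos (Real.pi / s i))) :
    (∫ U : GaugeConfig 4 N (Matrix.specialUnitaryGroup (Fin 3) ℂ), (if (∃ n : ℕ, ∃ u : Fin n → ({p // wilsonBox (0 : TorusSite 4 N) s p} → ℂ), ∃ ev wgt : Fin n → ℝ, (∀ i j, ∑ p, star (u i p) * u j p = if i = j then 1 else 0) ∧ (∀ j, (wilsonCell U μv 0 s).mulVec (u j) = fun p => (ev j : ℂ) * gammaFive p.1.2.2 p.1.2.2 * u j p) ∧ (∀ j, |ev j| < 2 * τ ∧ 0 ≤ wgt j ∧ wgt j * |ev j| ≤ 1) ∧ (∀ j, ‖∑ p, star (u j p) * gammaFive p.1.2.2 p.1.2.2 * u j p‖ < χ₀) ∧ 1 / (4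 * τ) < ∑ j, wgt j * ∑ p, if childrenInterior s p then (0 : ℝ) else ‖u j p‖ ^ 2) then (1 : ℝ) else 0) * ∏ f, ‖fermionDet (wilsonDirac (fundamentalRep (Fin 3)) U (mq f) 1)‖ ∂(wilsonMeasure (fundamentalRep (Fin 3)) β)) /
        (∫ U : GaugeConfig 4 N (Matrix.specialUnitaryGroup (Fin 3) ℂ), ∏ f, ‖fermionDet (wilsonDirac (fundamentalRep (Fin 3)) U (mq f) 1)‖ ∂(wilsonMeasure (fundamentalRep (Fin 3)) β)) = 0 := by
  have hE : ∀ U : GaugeConfig 4 N (Matrix.specialUnitaryGroup (Fin 3) ℂ), ¬ (∃ n : ℕ, ∃ u : Fin n → ({p // wilsonBox (0 : TorusSite 4 N) s p} → ℂ), ∃ ev wgt : Fin n → ℝ, (∀ i j, ∑ p, star (u i p) * u j p = if i = j then 1 else 0) ∧ (∀ j, (wilsonCell U μv 0 s).mulVec (u j) = fun p => (ev j : ℂ) * gammaFive p.1.2.2 p.1.2.2 * u j p) ∧ (∀ j, |ev j| < 2 * τ ∧ 0 ≤ wgt j ∧ wgt j * |ev j| ≤ 1) ∧ (∀ j, ‖∑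 p, star (u j p) * gammaFive p.1.2.2 p.1.2.2 * u j p‖ < χ₀) ∧ 1 / (4 * τ) < ∑ j, wgt j * ∑ p, if childrenInterior s p then (0 : ℝ) else ‖u j p‖ ^ 2) :=
    fun U hU => absurd (achiralPileup_kineticEdge_lt U s hs μv τ χ₀ hτ hU) (not_lt.mpr hedge)
  simp only [hE, if_false, zero_mul, integral_zero, zero_div]

/-- **Registered sub-goal form** (stub `stub5_event_empty_of_le_kineticEdge` of crux
stmt-QuantumFields-13901, line `chirality-collapses-pseudospectrum`): the B″ event of
`stub_achiralPileupRareOfPinned` at cell mass `μ`, level `τ ≥ 0`, cut `χ₀` is EMPTY on every box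
`s ≤ N` whose kinetic edge satisfies `2τχ₀ ≤ μ + Σ_i (1 − cos(π/s_i))`. -/
theorem stub5_event_empty_of_le_kineticEdge :
    ∀ (N : ℕ) [NeZero N] (U : GaugeConfig 4 N (Matrix.specialUnitaryGroup (Fin 3) ℂ)) (s : Fin 4 → ℕ) (μ τ χ₀ : ℝ), (∀ i, s i ≤ N) → 0 ≤ τ → 2 * τ * χ₀ ≤ μ + ∑ i, (1 - Real.cos (Real.pi / s i)) → ¬ (∃ n : ℕ, ∃ u : Fin n → ({p // wilsonBox (0 : TorusSite 4 N) s p} → ℂ), ∃ ev wgt : Fin n → ℝ, (∀ i j, ∑ p, star (u i p) * u j p = if i = j then 1 else 0) ∧ (∀ j, (wilsonCell U μ 0 s).mulVec (u j) = fun p => (ev j : ℂ) * gammaFive p.1.2.2 p.1.2.2 * u j p) ∧ (∀ j, |ev j| < 2 * τ ∧ 0 ≤ wgt j ∧ wgt j * |ev j| ≤ 1) ∧ (∀ j, ‖∑ p, star (u j p) * gammaFive p.1.2.2 p.1.2.2 * u j p‖ < χ₀) ∧ 1 / (4 * τ) < ∑ j, wgt j * ∑ p, if childrenInterior s p then (0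 : ℝ) else ‖u j p‖ ^ 2) := by
  intro N _ U s μ τ χ₀ hs hτ hedge hU
  exact absurd (achiralPileup_kineticEdge_lt U s hs μ τ χ₀ hτ hU) (not_lt.mpr hedge)

end Summit.QuantumFields.QCD.Cruxes.CoerciveSea.ChiralityCollapsesPseudospectrum

end
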